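import Literature.Barriers.AnomalousDissipation.AnomalousDissipationWithoutDissipationAnomaly
import Literature.Analysis.FluidPDE.CheskidovNoAnomalyFamily
import Literature.Analysis.FluidPDE.CheskidovNoAnomalyLift
import Literature.Analysis.FluidPDE.CheskidovNoAnomalyLimit
import HarnessLib

/-!
# Barrier (AnomalousDissipation): proof of the `2½`-dimensional assembly of Cheskidov 2023, Thm. 2.1

(D-0021 barrier catalogue for `Summits/AnomalousDissipation`.) The barrier fact
`Literature.Barriers.AnomalousDissipation.Cheskidov2023_thm21_noDissipationAnomaly`
(`AnomalousDissipationWithoutDissipationAnomaly.lean`; Cheskidov, arXiv:2311.04182, Thm. 2.1, second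
subfamily with energy level `e = 0`) is a statement about `2½`-dimensional fields on `T³`. Its
printed proof consists of a planar core (§3: the glued Alberti–Crippa–Mazzucato / Bruè–De Lellis
mixing flows and scalars; §4, (4.2)–(4.3) with the viscosities (4.19) `ν_m = m⁻¹λ_m⁻²`) and of the
`2½`-dimensional assembly (Lemma 3.2; §4 p. 12). The planar core is the named fact
`Literature.Analysis.FluidPDE.cheskidov_noAnomaly_family` (`CheskidovNoAnomalyFamily.lean`); this
file PROVES the assembly:

`Cheskidov2023_thm21_noDissipationAnomaly_of_noAnomalyFamily :
  cheskidov_noAnomaly_family → Cheskidov2023_thm21_noDissipationAnomaly`,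

with the witnesses of the source (§4 p. 12): `u_in = (0, ρ_in) ∘ π`, `u^m(t) = (v^m(t), θ^m(t)) ∘ π`
with zero pressure and the residual force (`= (g^m, 0) ∘ π` on `[0,2]`, `Torus.twoHalfForce`),
`f = (g, 0) ∘ π`, and `u(t) = (ṽ(t), ρ̃(t)) ∘ π` for `t < 1`, `u(t) = 0` for `t ≥ 1`. The clauses are
supplied by `CheskidovNoAnomalyLift.lean` (the Navier–Stokes family: classical solutions, force
convergence in `C([0,2]; C^α)`, energies `→ 1` on `[1,2]`, vanishing dissipation, weak vanishing
on `[1,2]`) and `CheskidovNoAnomalyLimit.lean` (the limit: classical on `[0,1)`, zero work, weak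
Euler solution on `[0,2]` through the singular time `t = 1`, strong/weak convergence before it).
Consequently the barrier's trust base is exactly the planar fact, i.e. Cheskidov 2023, Thm. 3.1
(Alberti–Crippa–Mazzucato 2019; Bruè–De Lellis 2023, Thm. 4.1), the gluing estimates of §3 /
Bruè–De Lellis Lemma 5.1, parabolic well-posedness on `T²`, and the energy estimate (4.3).

## References

* A. Cheskidov, *Dissipation anomaly and anomalous dissipation in incompressible fluid flows*,
  arXiv:2311.04182 (2023), Thm. 2.1, Lemma 3.2, §3, §4 pp. 12–13.
* E. Bruè, C. De Lellis, Comm. Math. Phys. 400 (2023), Thm. 4.1, Lemma 5.1.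
-/

noncomputable section

open MeasureTheory Set Filter
open _root_.Topology
open scoped ENNReal NNReal InnerProductSpace
open Literature.Analysis.FunctionSpaces.Torus (twoHalf planarProj)

namespace Literature.Barriers.AnomalousDissipation

open Literature.Analysis.FunctionSpaces Literature.Analysis.FluidPDE

/-- **Cheskidov 2023, Thm. 2.1 (`e = 0`), from its planar core.** The planar no-dissipation-anomaly
family (`Literature.Analysis.FluidPDE.cheskidov_noAnomaly_family`: Cheskidov 2023, §3 and §4 with
`ν_m = m⁻¹λ_m⁻²`) yields the barrier `Cheskidov2023_thm21_noDissipationAnomaly` through the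
`2½`-dimensional ansatz of the source (§4 p. 12): `u_in = (0, ρ_in)∘π`, `u^m = (v^m, θ^m)∘π` (zero
pressure, force `(g^m,0)∘π`), `f = (g,0)∘π`, `u = (ṽ, ρ̃)∘π` before `t = 1` and `u = 0` afterwards.
Every clause of Thm. 2.1 recorded in the barrier is derived: the classical Navier–Stokes family
(`Cheskidov.isClassicalNSSolutionOn_family`), `f^m → f` in `C([0,2]; C^α)`
(`Cheskidov.tendsto_iSup_eBoundedHolderNorm_force_sub`), the weak Euler limit on `[0,2]`
(`Cheskidov.isWeakNSSolutionForcedOn_limit`), classical on `[0,1)`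
(`Cheskidov.isClassicalNSSolutionOn_limit`), strong convergence in `C([0,t]; L²)`, `t < 1`, weak
convergence at every `t ∈ [0,2]`, `u = 0` on `[1,2]` with zero work
(`Cheskidov.intervalIntegrable_power_and_integral_eq_zero`), `‖u^m(t)‖_{L²} → 1` on `[1,2]`
(`Cheskidov.tendsto_eLpNorm_family`) and `ν_m∫₀ᵗ‖∇u^m‖² → 0` on `[0,2]`
(`Cheskidov.tendsto_cumulativeDissipation_family`). [cite: Cheskidov2023, Thm. 2.1, Lemma 3.2 and §4 p. 12] -/
theorem Cheskidov2023_thm21_noDissipationAnomaly_of_noAnomalyFamily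
    (h : Literature.Analysis.FluidPDE.cheskidov_noAnomaly_family) :
    Cheskidov2023_thm21_noDissipationAnomaly := by
  classical
  obtain ⟨ν, v, ρin, θ, ρ, vt, ρt, g, B, hν, hν0, hvS, -, hv0, hρin, hρin1, hθ, hE, hρ, hρfr, hρ01,
    hH, hstat, hprof, hbd, hρt1, hvan, hρw, hL2, hgv, hg, hg0, hgB, hforce⟩ := h
  -- `ṽ(0) = 0` and `ρ̃(0) = ρ_in` (eventual stationarity at `T = 0`)
  obtain ⟨m₁, hm₁⟩ := hstat 0 ⟨le_rfl, one_pos⟩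
  obtain ⟨hv00, hρ00⟩ := hm₁ m₁ le_rfl 0 ⟨le_rfl, le_rfl⟩
  have hvt0 : vt 0 = 0 := by rw [← hv00]; exact hv0 m₁ 0 (fun h' => lt_irrefl (0 : ℝ) h'.1)
  have hρt0 : ρt 0 = ρin := by rw [← hρ00]; exact (hρ m₁).2
  have hθ' : ∀ m, Torus.IsClassicalScalarTransportOn (Icc 0 2) (ν m) (v m) (θ m) := fun m => (hθ m).1
  have hρ' : ∀ m, Torus.IsClassicalScalarTransportOn (Icc 0 2) 0 (v m) (ρ m) := fun m => (hρ m).1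
  have hρ1 : ∀ m, ∀ t ∈ Icc (0 : ℝ) 2, ∫ x, ρ m t x ^ 2 = 1 := fun m t ht => (hρ01 m t ht).2
  have hρ0 : ∀ m, ∀ t ∈ Icc (0 : ℝ) 2, Literature.Analysis.FunctionSpaces.Torus.HasZeroMean (ρ m t) := fun m t ht => (hρ01 m t ht).1
  have hvtB : ∀ t ∈ Ico (0 : ℝ) 1, ∀ y, ‖vt t y‖ ≤ B := fun t ht y => (hbd t ht y).1
  have hpow := Cheskidov.intervalIntegrable_power_and_integral_eq_zero hprof hg hvtB hgB hvt0 hvan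
  refine ⟨twoHalf 0 ρin, ν, fun m => Torus.twoHalfForce (Icc 0 2) (ν m) (v m) (θ m) (fun _ _ => 0),
    fun m t => twoHalf (v m t) (θ m t),
    fun _ _ => (fun _ : UnitAddTorus (Fin 2) => (0 : ℝ)) ∘ planarProj,
    fun t => twoHalf (g t) 0, fun t => if t < 1 then twoHalf (vt t) (ρt t) else 0,
    ?_, ?_, hν, hν0, ?_, ?_, ?_, ?_, ?_, ?_, ?_, hpow.1, hpow.2, ?_, ?_⟩
  -- the datum is smooth with unit energy
  · exact (Literature.Analysis.FunctionSpaces.Torus.isSmooth_const (0 : EuclideanSpace ℝ (Fin 2))).twoHalf hρin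
  · rw [Torus.eLpNorm_twoHalf_zero_left hρin.continuous.aestronglyMeasurable]
    exact eLpNorm_two_eq_one_of_integral_sq (hρin.memLp 2) hρin1
  -- the Navier–Stokes family and the convergence of its forces
  · exact fun m => Cheskidov.isClassicalNSSolutionOn_family (hvS m) (hv0 m) (hθ' m) (hθ m).2
  · exact fun α hα0 hα1 => Cheskidov.tendsto_iSup_eBoundedHolderNorm_force_sub hvS hθ' (hforce α hα0 hα1)
  -- the limit: weak on `[0,2]`, classical on `[0,1)`
  · exact Cheskidov.isWeakNSSolutionForcedOn_limit hprof hg hg0 hbd hgB hvt0 hρt0 hρt1 hvan hρw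
  · exact ⟨_, Cheskidov.isClassicalNSSolutionOn_limit hprof hg⟩
  -- strong convergence before `t = 1`
  · exact fun T hT => Cheskidov.tendsto_iSup_eLpNorm_family_sub_limit hθ' hρ' hstat hL2 hT
  -- weak convergence at every time
  · intro t ht w hw
    rcases lt_or_ge t 1 with h1 | h1
    · exact Cheskidov.tendsto_integral_inner_family_of_lt_one hθ' hρ' hstat hL2 ⟨ht.1, h1⟩ hw
    · have h := Cheskidov.tendsto_integral_inner_family_of_mem_Icc hv0 hθ' hρ' hρfr hρ0 hH hE hν hL2
        ⟨h1, ht.2⟩ hw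
      have hz : (∫ x, ⟪(if t < 1 then twoHalf (vt t) (ρt t) else 0) x, w x⟫_ℝ) = 0 := by
        simp [if_neg (not_lt.2 h1)]
      rw [hz]
      exact h
  -- the limit vanishes on `[1,2]`
  · exact fun t ht => if_neg (not_lt.2 ht.1)
  -- no dissipation anomaly: energies stay `1` on `[1,2]`, the dissipation vanishes on `[0,2]`
  · exact fun t ht => Cheskidov.tendsto_eLpNorm_family hv0 hθ' hρ' hρ1 hL2 ht
  · intro t ht
    exact Cheskidov.tendsto_cumulativeDissipation_family hν hvS hθ' hE hgv
      (Cheskidov.tendsto_integral_sq_scalar hθ' hρ' hρ1 hL2 (t := 2) ⟨zero_le_two, le_rfl⟩) ht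

end Literature.Barriers.AnomalousDissipation

end
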